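import Summits.ABC.IUTFork.Joshi.ATS4Statements
import Literature.NumberTheory.EllipticCurves.SzpiroOfAbcProofs
import HarnessLib

/-!
# Joshi, *Arithmetic Teichmüller Spaces IV: proof of the abc-conjecture* (arXiv:2403.10430v2) §2.7–§2.10 and §3 —
# the THEOREMS as statements (van Frankenhuysen, Mochizuki's refinement, the «Main Theorem», Thm 3.3.1), typed

Record file of the abc-iut cell, branch E «type Joshi's construction, test vs S» (rung LADDER-ABC:A2.E; seat
abc-iut-E-t24, slot T-24, plan/E/OBJECTS.tsv row O-051; JOSHI-DAG nodes J4:Thm2.7.1, J4:Thm2.8.1, J4:Rmk2.8.2,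
J4:Thm2.10.1, J4:Rmk2.10.2, J4:Thm3.3.1, J4:Rmk3.3.2; companion of `ATS4Statements.lean`, whose conjecture statements
`AbcConjecture`, `ArithmeticSzpiroConjecture`, `CurveHeightDatum.VojtaHeightInequality`, `StrongAbcConjecture` it uses).
**No side is taken** on [IUTchIII] Cor. 3.12, on Joshi's claims, or on Mochizuki's report on them; the source is an
unrefereed arXiv preprint («Preliminary version for comments», v2, 80 pp.; render
`HOME/lit/renders/Joshi-arxiv-2403.10430/`, «p.N l.M» = line M of page file pNNNN.txt). TYPED ≠ PROVED ≠ ENDORSED.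
This file makes NO abc claim: Joshi's Theorem 2.10.1 («Main Theorem» = Vojta's height inequality for all curves,
whence abc and Szpiro) is typed as a NAMED `Prop` carrying `@[claim "Joshi2024ATS4" "disputed"]`, never asserted; what
IS proved are only implications AMONG STATEMENTS that are formal or already kernel-checked in the tree.

## Contents (node ↦ declaration; «our side» decls are IMPORTED BY NAME, never restated)

* **J4:Thm2.7.1** (p.32 l.31–33; van Frankenhuysen 2002) strong abc ⟺ Vojta HI for curves, and **J4:Thm2.8.1** (p.33
  l.9–13; [Mochizuki 2010] = [GenEll] Thm. 2.1): typed as READING PREDICATES on an abstract family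
  `𝔛 : ι → CurveHeightDatum` standing for «all hyperbolic curves over number fields with their genuine height data» (not
  constructible in the tree; TODO(general form)); the directions that are formal are **PROVED**
  (`strongAbcConjecture_of_family`, `abcOnCompactlyBoundedSubsets_of_strongAbcConjecture`,
  `vanFrankenhuysenEquivalence_of`, `mochizukiRefinement_of`), and Thm 2.8.1 (2) ⟹ strong abc is **PROVED modulo the
  FACT-LIST fact F-1336** `GenEll.GenEll_thm21_primes`, taken as a hypothesis (`strongAbcConjecture_of_abcOnCompactlyBounded`).
* **J4:Thm2.10.1** (p.34 l.13–21) Joshi's MAIN THEOREM as the named Prop `MainTheorem 𝔛` (`@[claim … "disputed"]`);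
  consequences (1) strong abc + abc and (2) Szpiro over `ℚ` **PROVED AS IMPLICATIONS** from it
  (`consequences_of_mainTheorem`; consequence (2) uses the tree's kernel-checked `szpiro_of_abcLe_holds`,
  Silverman AEC VIII.11.5(b) / Bombieri–Gubler 12.5.12); (2) over number fields is the named Prop
  `SzpiroOverNumberFields` (= `∀ K, SzpiroConjectureOver K`); (3) effective Mordell is NOT typable in the tree (no
  curves of genus `≥ 2` / effective Faltings; cf. `AbcWave0` abc.S14) — docstring only. **J4:Rmk2.10.2**: the paper's own
  route (Thm 2.8.1 (2) for a suitable finite set of primes) as the implication `ABC_of_abcOnCompactlyBounded`.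
* **J4:Thm3.3.1** (p.35 l.34 – p.37 l.4) «differents … are measures of the additive structure»; only its «In particular
  … `y ↦ 𝔡_{M/L;y}` is a non-constant function on `𝒴_L`» carries typable content: `DifferentNonConstant` over the
  INTERIM CARRIER `ArithmeticoidDifferentDatum` (merge-debt: Joshi's `𝒴_L` = ATS II½ arXiv:2305.10398 §4–§5, batch-2
  slots T-36/T-37, and E-t1's `𝔍(X, L)` of ATS I).

Faithfulness flags for the referee lanes: docstrings of `MochizukiRefinement` (binder `d` outside the equivalence) and
`MainTheorem` (hyperbolicity; consequence (3)); plan/E/t24/INVENTORY.tsv. [claim: Joshi2024ATS4, status: disputed]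
(unrefereed preprint); [cite: MochizukiGenEll2010]; standard axioms only.
-/

noncomputable section

open Literature.NumberTheory.DiophantineGeometry Literature.NumberTheory.DiophantineGeometry.GenEll
open Literature.NumberTheory.EllipticCurves

namespace Summit.ABC.IUTFork.Joshi.ATS4

universe u v

/-! ## §2.7 van Frankenhuysen's Theorem (J4:Thm2.7.1, p.32 l.26–33)

«In [Vojta, 1998], it had been shown that Vojta's Height Inequality for Curves (Conjecture 2.5.1) implies the abc-conjecture
(Conjecture 2.1.1). The converse of this assertion is the following theorem of [van Frankenhuysen, 2002]» (M. van
Frankenhuysen, *The ABC conjecture implies Vojta's height inequality for curves*, J. Number Theory 95 (2002) 289–302;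
refereed; no bib key in the tree — cited through Joshi's statement). The quantifier «for all curves» is modelled by an
abstract family `𝔛 : ι → CurveHeightDatum` (READING PREDICATE: the theorem is the predicate AT the genuine family). -/

namespace CurveHeightDatum

/-- The substance of Thm. 2.7.1, direction (1) ⟹ (2), FOR THE CURVE DATUM `𝔛`: the strong abc-conjecture implies Vojta's
Height Inequality for `𝔛` (van Frankenhuysen 2002, for genuine hyperbolic `(X, D)/L`). A reading predicate; PROVED only for
the tripod (`tripod_strongAbcImpliesVojta`). [cite: Joshi2024ATS4, Thm 2.7.1 p.32 l.31–33] -/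
def StrongAbcImpliesVojta (𝔛 : CurveHeightDatum.{u}) : Prop :=
  StrongAbcConjecture → 𝔛.VojtaHeightInequality

/-- For the tripod, (1) ⟹ (2) of Thm. 2.7.1 is definitional. PROVED. [cite: Joshi2024ATS4, Thm 2.7.1 p.32 l.31–33] -/
theorem tripod_strongAbcImpliesVojta : tripod.StrongAbcImpliesVojta :=
  fun h => vojtaHeightInequality_tripod_iff.mpr h

end CurveHeightDatum

/-- **[J-IV] Theorem 2.7.1 ([van Frankenhuysen, 2002]) AS PRINTED, for a family `𝔛` of curve data** (p.32 l.31–33): «The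
following conjectures are equivalent: (1) The strong abc-conjecture (Conjecture 2.6.1). (2) Vojta's Height Inequality for
Curves (Conjecture 2.5.1).» — with (2) read as «for every member of the family». The theorem is this predicate at the family of
ALL hyperbolic curves over number fields with their genuine height data (not constructible in the tree; TODO(general form));
`vanFrankenhuysenEquivalence_of` isolates what it takes. [cite: Joshi2024ATS4, Thm 2.7.1 p.32 l.31–33] -/
def VanFrankenhuysenEquivalence {ι : Type v} (𝔛 : ι → CurveHeightDatum.{u}) : Prop :=
  StrongAbcConjecture ↔ ∀ i, (𝔛 i).VojtaHeightInequality

/-- Direction (2) ⟹ (1) of Thm. 2.7.1 is formal for any family CONTAINING the tripod (Conj. 2.6.1 is the special case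
`(X, D, L) = (ℙ¹, {0,1,∞}, ℚ)` of Conj. 2.5.1). PROVED. [cite: Joshi2024ATS4, Thm 2.7.1 p.32 l.31–33] -/
theorem strongAbcConjecture_of_family {ι : Type v} (𝔛 : ι → CurveHeightDatum.{1}) (i₀ : ι)
    (h₀ : 𝔛 i₀ = CurveHeightDatum.tripod) (h : ∀ i, (𝔛 i).VojtaHeightInequality) : StrongAbcConjecture :=
  vojtaHeightInequality_tripod_iff.mp (h₀ ▸ h i₀)

/-- Thm. 2.7.1 for a family holds as soon as the family contains the tripod and van Frankenhuysen's implication holds for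
each member — i.e. the printed equivalence = (trivial direction) + (van Frankenhuysen 2002 memberwise). PROVED.
[cite: Joshi2024ATS4, Thm 2.7.1 p.32 l.31–33] -/
theorem vanFrankenhuysenEquivalence_of {ι : Type v} (𝔛 : ι → CurveHeightDatum.{1}) (i₀ : ι)
    (h₀ : 𝔛 i₀ = CurveHeightDatum.tripod) (hvF : ∀ i, (𝔛 i).StrongAbcImpliesVojta) :
    VanFrankenhuysenEquivalence 𝔛 :=
  ⟨fun h i => hvF i h, strongAbcConjecture_of_family 𝔛 i₀ h₀⟩

/-! ## §2.8 Mochizuki's Refinement of van Frankenhuysen's Theorem (J4:Thm2.8.1, p.33 l.1–21)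

[Mochizuki, 2010, Theorem 2.1] = [GenEll] Thm. 2.1, whose `(ℙ¹_ℚ, [0]+[1]+[∞])`-vocabulary (compactly bounded subsets
`GenEll.CBData` — J4 §5.1 = [GenEll] Ex. 1.3 (ii) —, `GenEll.VojtaIneq`, `GenEll.ABCCompactlyBounded`, the named fact
`GenEll.GenEll_thm21_primes` = FACT-LIST F-1336) is in the tree. Rmk. 2.8.2 (p.33 l.14–21, [Wada, 2021]: the conductor
exponent cannot be improved even on compactly bounded subsets) is expository; the registry's «Rmk2.8.2 (1)–(8)» are the items
of §2.9 «A brief history» (p.33 l.22 – p.34 l.7), expository. -/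

/-- **Statement (2) of [J-IV] Thm. 2.8.1** (p.33 l.12–13): «Conjecture 2.6.1 holds for any `S`-supported compactly bounded
subset of `U(Q̄)_{≤d} = ℙ¹ − {0, 1, ∞}(Q̄)_{≤d}`», `S` «a finite set of primes including archimedean primes» (p.33 l.9–10) — here
`S : Finset ℕ` is its nonarchimedean part (the support of a `GenEll.CBData` always contains `∞`), and «`S`-supported» = «whose
support contains `S`» ([GenEll] Thm. 2.1 (ii)): for every `ε > 0` and every compactly bounded `K_V` with support `⊇ S`,
`ht ≲ (1+ε)(log-diff + log-con)` on `K_V ∩ U(Q̄)_{≤d}`. Over the tree BY NAME; `GenEll.ABCCompactlyBounded S` is `∀ d ≥ 1` of it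
(`abcCompactlyBounded_iff`). [cite: Joshi2024ATS4, Thm 2.8.1 (2) p.33 l.12–13] -/
def AbcOnCompactlyBoundedSubsets (S : Finset ℕ) (d : ℕ) : Prop :=
  ∀ ε : ℝ, 0 < ε → ∀ K : CBData, K.SupportContains S → VojtaIneq K.toSet d ε

/-- [GenEll] Thm. 2.1 (ii) for `Σ = S` (tree: `GenEll.ABCCompactlyBounded S`) is statement (2) of Thm. 2.8.1 for every
`d ≥ 1`. PROVED (definitional). [cite: Joshi2024ATS4, Thm 2.8.1 (2) p.33 l.12–13] -/
theorem abcCompactlyBounded_iff (S : Finset ℕ) :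
    ABCCompactlyBounded S ↔ ∀ d : ℕ, 0 < d → AbcOnCompactlyBoundedSubsets S d :=
  Iff.rfl

/-- (1)|_{ℙ¹} ⟹ (2) of Thm. 2.8.1: the strong abc-conjecture restricts to every compactly bounded subset («immediate from the
definitions», [GenEll] p. 11). PROVED. [cite: Joshi2024ATS4, Thm 2.8.1 p.33 l.9–13] -/
theorem abcOnCompactlyBoundedSubsets_of_strongAbcConjecture (h : StrongAbcConjecture) (S : Finset ℕ) {d : ℕ}
    (hd : 0 < d) : AbcOnCompactlyBoundedSubsets S d :=
  fun ε hε _ _ => (h d hd ε hε).mono (Set.inter_subset_inter_left _ (Set.subset_univ _))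

/-- **[J-IV] Theorem 2.8.1 ([Mochizuki, 2010]) AS PRINTED, for a family `𝔛` of curve data** (p.33 l.9–13): «Let `S` be a
finite set of primes including archimedean primes. Let `d ≥ 1` be an integer. Then the following are equivalent: (1) Vojta's
Height Inequality for Curves (Conjecture 2.5.1) holds. (2) Conjecture 2.6.1 holds for any `S`-supported compactly bounded
subset of `U(Q̄)_{≤d} = ℙ¹ − {0, 1, ∞}(Q̄)_{≤d}`.» FAITHFULNESS FLAG (for the referee lanes, no side taken): as printed the
integer `d` is bound OUTSIDE the equivalence, so the literal (2)_d ⟹ (1) is, for fixed `d`, STRONGER than what [GenEll]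
Thm. 2.1 states and proves — there `d` is bound inside both (i) and (ii) (the noncritical Belyi maps of the proof raise the
degree); the tree's faithful transcription is `GenEll.GenEll_thm21_primes` ((ii) for all `d` ⟹ (i)|_{ℙ¹} for all `d`), used in
`strongAbcConjecture_of_abcOnCompactlyBounded`. Reading predicate at the genuine family. [cite: Joshi2024ATS4, Thm 2.8.1 p.33 l.9–13] -/
def MochizukiRefinement {ι : Type v} (𝔛 : ι → CurveHeightDatum.{u}) (S : Finset ℕ) (d : ℕ) : Prop :=
  (∀ i, (𝔛 i).VojtaHeightInequality) ↔ AbcOnCompactlyBoundedSubsets S d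

/-- (1) ⟹ (2) of Thm. 2.8.1 for any family containing the tripod and any `d ≥ 1`. PROVED.
[cite: Joshi2024ATS4, Thm 2.8.1 p.33 l.9–13] -/
theorem abcOnCompactlyBoundedSubsets_of_family {ι : Type v} (𝔛 : ι → CurveHeightDatum.{1}) (i₀ : ι)
    (h₀ : 𝔛 i₀ = CurveHeightDatum.tripod) (h : ∀ i, (𝔛 i).VojtaHeightInequality) (S : Finset ℕ) {d : ℕ}
    (hd : 0 < d) : AbcOnCompactlyBoundedSubsets S d :=
  abcOnCompactlyBoundedSubsets_of_strongAbcConjecture (strongAbcConjecture_of_family 𝔛 i₀ h₀ h) S hd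

/-- **(2) for all `d` ⟹ the strong abc-conjecture, modulo the FACT-LIST fact F-1336** `GenEll.GenEll_thm21_primes` ([GenEll]
Thm. 2.1 (ii) ⟹ (i)|_{ℙ¹}, for `Σ` a finite set of PRIME numbers), taken as an explicit hypothesis: PROVED as an implication.
This is the form in which Joshi uses Thm. 2.8.1 (Rmk. 2.10.2: «prove [(2)] for a given compactly bounded subset supported
on a suitable finite set of primes»). [cite: Joshi2024ATS4, Thm 2.8.1 p.33 l.9–13] -/
theorem strongAbcConjecture_of_abcOnCompactlyBounded (hfact : GenEll_thm21_primes) {S : Finset ℕ}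
    (hS : ∀ p ∈ S, p.Prime) (h : ∀ d : ℕ, 0 < d → AbcOnCompactlyBoundedSubsets S d) : StrongAbcConjecture :=
  fun d hd => hfact S hS ((abcCompactlyBounded_iff S).mpr h) d hd

/-- Thm. 2.8.1 for a family and a finite set `S` of prime numbers holds for every `d ≥ 1` as soon as the family contains the
tripod, van Frankenhuysen's implication holds memberwise, statement (2) is available at ALL degrees whenever it is at `d`
(the degree-raising content of [GenEll]'s proof, made explicit), and F-1336 holds. PROVED as an implication.
[cite: Joshi2024ATS4, Thm 2.8.1 p.33 l.9–13] -/
theorem mochizukiRefinement_of {ι : Type v} (𝔛 : ι → CurveHeightDatum.{1}) (i₀ : ι)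
    (h₀ : 𝔛 i₀ = CurveHeightDatum.tripod) (hvF : ∀ i, (𝔛 i).StrongAbcImpliesVojta) (hfact : GenEll_thm21_primes)
    {S : Finset ℕ} (hS : ∀ p ∈ S, p.Prime) {d : ℕ} (hd : 0 < d)
    (hdeg : AbcOnCompactlyBoundedSubsets S d → ∀ d' : ℕ, 0 < d' → AbcOnCompactlyBoundedSubsets S d') :
    MochizukiRefinement 𝔛 S d :=
  ⟨fun h => abcOnCompactlyBoundedSubsets_of_family 𝔛 i₀ h₀ h S hd,
    fun h i => hvF i (strongAbcConjecture_of_abcOnCompactlyBounded hfact hS (hdeg h))⟩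

/-! ## §2.10 The Main Theorem (J4:Thm2.10.1, J4:Rmk2.10.2; p.34 l.8–25)

«The following assertion of [Mochizuki, 2021d], together with the present series of papers ([Joshi, 2020a, 2022, 2023b,a,
2024c] and [Joshi, 2020a, 2019]) or [Mochizuki, 2021a,b,c] together with the corrections and changes suggested in the
'Rosetta Stone' of [Joshi, 2024c, § 8], establish: Theorem 2.10.1» (p.34 l.9–12). A CLAIM of an unrefereed preprint,
rejected by the IUT author (Mochizuki2024JoshiReport) and accepted by neither side of the dispute; typed as a named `Prop`,
NEVER asserted; the repair branch (B3, plan/repair/CANDIDATES.tsv RP-J01…) black-boxes Joshi's claims as hypotheses. -/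

/-- **[J-IV] Theorem 2.10.1 (Main Theorem) — Joshi's CLAIM, as a named Prop on a family `𝔛` of curve data** (p.34 l.13–17):
«Let `(X, D)/L` be a geometrically connected, smooth, projective curve over a number field `L` and let `D ⊂ X` be a reduced
divisor over `L`. Let `d ≥ 1` be an integer. Then for every `ε > 0`, Vojta's Height Inequality `ht_{ω_X(D)} ≲ (1 + ε)
(log-diff_X + log-con_D)` holds on `U(Q̄)_{≤d} = (X − D)(Q̄)_{≤d}`.» = Conj. 2.5.1 for every member of the family (the genuine
family of all such `(X, D)/L` is not constructible in the tree). FAITHFULNESS NOTES: (a) the display omits the hyperbolicity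
hypothesis of Conj. 2.5.1 (for non-hyperbolic `U`, `ω_X(D)` has degree `≤ 0`); (b) «As a consequence the following assertions
are also true: (1) The strong abc-conjecture (and abc-conjecture). (2) The Arithmetic Szpiro Inequality (Conjecture 2.2.1) for
elliptic curves over number fields. (3) Effective form of Mordell's Conjecture is true for `X/L`» (p.34 l.18–21): (1) and
(2) over `ℚ` are PROVED consequences below; (2) over number fields is `SzpiroOverNumberFields`; (3) is NOT typable here (no
genus-`≥ 2` curves / effective Faltings in the tree; cf. `AbcWave0` abc.S14). CLAIM (disputed, unrefereed); never asserted;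
NO abc claim is made by typing it. [cite: Joshi2024ATS4, Thm 2.10.1 p.34 l.13–21] -/
@[claim "Joshi2024ATS4" "disputed"]
def MainTheorem {ι : Type v} (𝔛 : ι → CurveHeightDatum.{u}) : Prop :=
  ∀ i, (𝔛 i).VojtaHeightInequality

/-- Consequence (2) of Thm. 2.10.1 in its number-field generality: «The Arithmetic Szpiro Inequality (Conjecture 2.2.1) for
elliptic curves over number fields» (p.34 l.20) = the tree's `SzpiroConjectureOver K` (Silverman ATAEC Conj. IV.10.6) for every
number field `K`. A named statement; not asserted; its derivation from `MainTheorem` needs Vojta ⟹ Szpiro over `K`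
(Frey curves over `K`), which the tree proves only over `ℚ` (`szpiroConjecture_of_strongAbcConjecture`).
[cite: Joshi2024ATS4, Thm 2.10.1 (2) p.34 l.20] -/
def SzpiroOverNumberFields : Prop :=
  ∀ (K : Type) [Field K] [NumberField K], SzpiroConjectureOver K

/-- The Main Theorem at any family containing the tripod yields consequence (1): the strong abc-conjecture, hence Joshi's
abc-conjecture 2.1.1 and the summit statement `ABC`. PROVED AS AN IMPLICATION from the named claim; nothing is asserted.
[cite: Joshi2024ATS4, Thm 2.10.1 (1) p.34 l.19] -/
theorem strongAbcConjecture_of_mainTheorem {ι : Type v} (𝔛 : ι → CurveHeightDatum.{1}) (i₀ : ι)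
    (h₀ : 𝔛 i₀ = CurveHeightDatum.tripod) (h : MainTheorem 𝔛) :
    StrongAbcConjecture ∧ AbcConjecture ∧ ABC :=
  have hs := strongAbcConjecture_of_family 𝔛 i₀ h₀ h
  ⟨hs, abcConjecture_of_strongAbcConjecture hs, ABC_of_strongAbcConjecture hs⟩

/-- Consequence (2) over `ℚ`: the strong abc-conjecture implies the Arithmetic Szpiro Conjecture 2.2.1 — PROVED (kernel) via
the tree's `szpiro_of_abcLe_holds` (abc over `ℚ` ⟹ Szpiro, Silverman AEC Prop. VIII.11.5(b) / Bombieri–Gubler Thm. 12.5.12,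
kernel-checked in `SzpiroOfAbcProofs.lean`). An implication between statements. [cite: Joshi2024ATS4, Thm 2.10.1 (2) p.34 l.20] -/
theorem szpiroConjecture_of_strongAbcConjecture (h : StrongAbcConjecture) :
    ArithmeticSzpiroConjecture ∧ SzpiroConjecture := by
  have habc := abc_of_vojtaP1Deg h
  have hle : ∀ ε : ℝ, 0 < ε → ∃ C : ℝ, ∀ a b c : ℕ, IsABCTriple a b c →
      (c : ℝ) ≤ C * ((rad a b c : ℕ) : ℝ) ^ (1 + ε) := fun ε hε => by
    obtain ⟨C, -, hC⟩ := habc ε hε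
    exact ⟨C, fun a b c ht => (hC a b c ht).le⟩
  have hS : SzpiroConjecture := szpiro_of_abcLe_holds hle
  exact ⟨arithmeticSzpiroConjecture_iff.mpr hS, hS⟩

/-- **Consequences (1) and (2)|_ℚ of [J-IV] Thm. 2.10.1, PROVED as implications from the named claim** at any family
containing the tripod: strong abc, abc (Joshi's 2.1.1 and the summit `ABC`), Arithmetic Szpiro 2.2.1. Nothing is asserted:
`MainTheorem 𝔛` is a hypothesis. [cite: Joshi2024ATS4, Thm 2.10.1 p.34 l.18–21] -/
theorem consequences_of_mainTheorem {ι : Type v} (𝔛 : ι → CurveHeightDatum.{1}) (i₀ : ι)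
    (h₀ : 𝔛 i₀ = CurveHeightDatum.tripod) (h : MainTheorem 𝔛) :
    StrongAbcConjecture ∧ AbcConjecture ∧ ABC ∧ ArithmeticSzpiroConjecture := by
  obtain ⟨hs, hj, hA⟩ := strongAbcConjecture_of_mainTheorem 𝔛 i₀ h₀ h
  exact ⟨hs, hj, hA, (szpiroConjecture_of_strongAbcConjecture hs).1⟩

/-- **Rmk. 2.10.2, the paper's own route** (p.34 l.23–25): «The strategy of the proof of Theorem 2.10.1 is to prove Theorem
2.10.1(2) [READING: Thm. 2.8.1 (2) — 2.10.1 (2) is Szpiro] for a given compactly bounded subset supported on a suitable finite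
set of primes.» In the typed vocabulary: statement (2) of Thm. 2.8.1 for a finite set `S` of primes AT ALL DEGREES, plus F-1336,
gives the strong abc-conjecture and hence `ABC` — PROVED as an implication (this is what [J-IV] §§5–7, E-t4's O-050 / batch-2
slots T-28…T-33, would have to feed; cf. the tree's [IUTchIV] chain `Literature.IUT.LogVolume.Cor22.abc_of_corollary22_primes`
for `S = {2}`). [cite: Joshi2024ATS4, Rmk 2.10.2 p.34 l.22–25] -/
theorem ABC_of_abcOnCompactlyBounded (hfact : GenEll_thm21_primes) {S : Finset ℕ} (hS : ∀ p ∈ S, p.Prime)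
    (h : ∀ d : ℕ, 0 < d → AbcOnCompactlyBoundedSubsets S d) : StrongAbcConjecture ∧ ABC :=
  have hs := strongAbcConjecture_of_abcOnCompactlyBounded hfact hS h
  ⟨hs, ABC_of_strongAbcConjecture hs⟩

/-! ## §3 Averaging over Arithmetic Teichmuller Space of a Number Field (J4:Thm3.3.1, J4:Rmk3.3.2; p.34 l.26 – p.37 l.6)

§3.1–§3.2 are expository («a topological space `𝒴_L` (constructed in [Joshi, 2023a, § 4]) which parameterizes the many
inequivalent avatars of a fixed number field», p.35 l.12–13; [Joshi, 2023a] = ATS II½, arXiv:2305.10398 — NOT typed in the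
tree: merge-debt with batch-2 slots T-36/T-37 and E-t1's `𝔍(X, L)`). Thm. 3.3.1 (1), (2), (4) are interpretive sentences
(«are dependent on the additive structure … and hence are measures of the relative differences», «may not be directly
compared», «may be compared») with no formal content of their own; (3) «A choice of an anabelomorphism `G_{L_v,K_{y_v,1}} ≃
G_{L_v,K_{y_v,2}}` provides an isomorphism of topological groups `L^*_{v,1} ≃ L^*_{v,2}` and … of the unit groups» is the
standard mono-anabelian recovery of `K^×`, `𝒪_K^×` from `G_K` (tree analogue: `Literature.AnabelianGeometry.AbsoluteAnabelian`,
e.g. `galoisMLF_iso_unitImage`), entering below only as the common comparison groups `G v` of the carrier. The one typable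
assertion is the closing «In
particular … `y ↦ 𝔡_{M/L;y}` is a non-constant function on `𝒴_L`» (p.36 l.34–41); Rmk. 3.3.2 (p.37 l.4–6): «Theorem 3.3.1 is
not useful in practical computations or estimates.» No bearing on the residual `S` of the cell. -/

/-- **INTERIM CARRIER for [J-IV] Thm. 3.3.1** (p.35 l.34 – p.36 l.41): for a number field `L` «with no real embeddings», a
finite Galois `M/L` and chosen primes `w ∣ v`, the data the theorem speaks about — the points `y ∈ 𝒴_L` (normalized
arithmeticoids `arith(L)^nor_y`, [Joshi, 2023a, § 5]), the places `v ∈ V_L`, for each place a COMMON comparison group (the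
`L_v^*` in which, after «a choice of an anabelomorphism» (3) and the transport (4), the differents «may be compared»), and the
different `𝔡_{M/L;y} = (𝔡_{M_w/L_v;y})_{v ∈ V_L} ∈ ∏_v K^*_{y_v}` read in those common groups. SIGNATURE ONLY (merge-debt:
ATS II½ arXiv:2305.10398 §4–§5 carriers, slots T-36/T-37; E-t1's ATS I `𝔍(X, L)`). [cite: Joshi2024ATS4, Thm 3.3.1 p.35 l.34–p.36 l.41] -/
structure ArithmeticoidDifferentDatum : Type (u + 1) where
  /-- the points `y` of Joshi's arithmetic Teichmüller space `𝒴_L` of the number field `L` -/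
  Y : Type u
  /-- the places `v ∈ V_L` -/
  V : Type u
  /-- the common comparison group at `v` (the multiplicative group `L_v^*` after the identifications (3)–(4)) -/
  G : V → Type u
  /-- `y ↦ 𝔡_{M/L;y} = (𝔡_{M_w/L_v;y})_v`, transported to the common groups -/
  diff : Y → (v : V) → G v

/-- **[J-IV] Theorem 3.3.1, closing assertion — Joshi's CLAIM, as a named Prop on the datum `𝒜`** (p.36 l.34–41): «In particular
`𝔡_{M/L;y} = (𝔡_{M_w/L_v,y})_{v∈V_L} ∈ ∏_{v∈V_L} K^*_{y_v}` depends on the arithmeticoid `arith(L)_y` for `y ∈ 𝒴_L`, and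
`y ↦ 𝔡_{M/L;y}` is a non-constant function on `𝒴_L`.» («Proof. This was established in [Joshi, 2020a, Theorem 4.1] for the case
of distinct anabelomorphic `p`-adic fields … this principal underlying the proof in that case is equally valid for distinct
arithmeticoids», p.36 l.42–45.) Rmk. 3.3.2: «not useful in practical computations or estimates». CLAIM (disputed,
unrefereed); never asserted; no bearing on `S`. [cite: Joshi2024ATS4, Thm 3.3.1 p.36 l.34–41] -/
@[claim "Joshi2024ATS4" "disputed"]
def DifferentNonConstant (𝒜 : ArithmeticoidDifferentDatum.{u}) : Prop :=
  ∃ y₁ y₂ : 𝒜.Y, 𝒜.diff y₁ ≠ 𝒜.diff y₂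

/-- A datum on which the different IS constant (e.g. a one-point `𝒴_L`) does not satisfy the claim: the assertion has content
only through the genuine `𝒴_L` (sanity check that the Prop is not vacuous-by-typing). [cite: Joshi2024ATS4, Thm 3.3.1 p.36 l.34–41] -/
theorem not_differentNonConstant_of_subsingleton (𝒜 : ArithmeticoidDifferentDatum.{u}) [Subsingleton 𝒜.Y] :
    ¬ DifferentNonConstant 𝒜 :=
  fun ⟨y₁, y₂, h⟩ => h (by rw [Subsingleton.elim y₁ y₂])

end Summit.ABC.IUTFork.Joshi.ATS4

end
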